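import Literature.NumberTheory.Rogawski1990.ArchCentralLimitAngleChart       -- ★ p842695∕p842935 (this seat): the angle chart at the centre, chamber-by-chamber reduction
import Literature.NumberTheory.Automorphic.ArchCentralDescentRankTwoEngine      -- ★ p842447 (this seat): `contDiff_rhoWeylDelta_ray`, `eventually_injective_ray`
import HarnessLib

/-!
# ONE CHAMBER: a `C³` CORNER EXTENSION of `F_Θ = ρ′Δ·Φ_Θ` from an open cone of angles gives the (L_{U(2,1)}) letter's limit FROM THAT CONE, with value `ω H(0)` read on the extension
# (Rogawski 1990 §8.4 p. 126 «`ω[ρ′ΔΦ]` is continuous at `γ₀`»; ROAD A brick (B-1) of the N1 assembly skeleton, F0P3a-p02 (g12) census a4f70f9f (α1))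

Topic `NumberTheory/Rogawski1990`; namespace `Literature.NumberTheory.Rogawski1990`.  THEOREMS ONLY (no `def`, no instance, no notation, no axiom, no named fact, no `sorry`).
Cell `pub/hodgecm-mathlib`, ENGINE T1 (crux H413 = `stmt-HodgeConjecture-24833`); ROAD-Sd, «SdArch» ED. 3's one open stub N1 = ★ `ArchCentralLimitFormulaRankTwo` (ROAD A, owner F0P3a-p05 (g13));
(B-1) of p02 (g12)'s N1 assembly skeleton, cut by F0P3a-p03 (g11) (split by head 2026-09-01T08:5xZ), 2026-09-01.

THE STATEMENT (`Φ` a black box — the letter's orbital integral —, `C` ANY open set of angles, e.g. a Weyl chamber `{θ_{σ0} < θ_{σ1} < θ_{σ2}}`).  If on `C` near `θ = 0` the function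
`θ ↦ ρ′Δ(ζe^{iθ})·Φ(ζe^{iθ})` (the letter's `F_Θ` in the angle chart) AGREES with a `C³` function `H : ℝ³ → ℂ` (the corner extension — Harish-Chandra's boundary regularity, ROAD A (A6)), then
  `Λ₈[ρ′Δ·Φ](ζe^{iθ}) → (1∕48) Σ_ε s₀s₁s₂ · (d∕ds)³|₀ H(s·V_ε) = (ωH)(0)`   as `θ → 0` WITHIN `C`
(**`tendsto_lambda8_rhoWeylDelta_nhdsWithin_of_contDiff`**).  Mechanism (= ★ p842290 `tendsto_letterLambda_of_posDef` §B–§D localised to a cone): the eight ray functions at `ζe^{iθ}` ARE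
`s ↦ F(ζe^{i(θ + sV_ε)})` (`e^{iθ_k}e^{isv_k} = e^{i(θ+sv)_k}`); for `θ ∈ C ∩ W` (open) the ray stays inside for small `s`, where `F∘chart = H`, so each third derivative at `s = 0` is that of
`s ↦ H(θ + sV_ε)` (`Filter.EventuallyEq.iteratedDeriv_eq`); the latter is continuous in `θ` for `C³` `H` (`continuous_iteratedDeriv_three_line_of_contDiff`, the `C³` form of ★
`continuous_iteratedDeriv_three_line`).  With ★ `tendsto_nhdsWithin_injective_of_forall_chamber` (six chambers) this is the shape (B-2) feeds into the letter.
HONEST LABEL: HC_CM is proved only modulo the printed citations until rung 0 closes; calculus bookkeeping, pays nothing by itself — the corner extensions `H` are ROAD A's to produce.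

## References
* [Rogawski1990] J. D. Rogawski, *Automorphic Representations of Unitary Groups in Three Variables*, Ann. of Math. Stud. 123 (1990), §8.4 p. 126.
* [HormanderALPDO1] L. Hörmander, *The Analysis of Linear Partial Differential Operators I*, 2nd ed. (1990), Thm. 1.1.9.
-/

set_option autoImplicit false

noncomputable section

open Filter Topology Complex
open scoped ContDiff

namespace Literature.NumberTheory.Rogawski1990

open Literature.Analysis.Calculus Literature.NumberTheory.Automorphic.UnitaryGroup

section Line

/-- **Line third derivatives of a `C³` function on `ℝ³` are continuous in the base point** (★ `iteratedFDeriv_comp_affine` at order `3`; the `C³` form of ★ `continuous_iteratedDeriv_three_line`).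
[cite: HormanderALPDO1, Thm. 1.1.9] -/
theorem continuous_iteratedDeriv_three_line_of_contDiff {H : (Fin 3 → ℝ) → ℂ} (hH : ContDiff ℝ 3 H) (u : Fin 3 → ℝ) :
    Continuous fun θ : Fin 3 → ℝ => iteratedDeriv 3 (fun s : ℝ => H (s • u + θ)) 0 := by
  have hn : ((3 : ℕ) : ℕ∞ω) ≤ (3 : ℕ∞ω) := le_rfl
  have heq : (fun θ : Fin 3 → ℝ => iteratedDeriv 3 (fun s : ℝ => H (s • u + θ)) 0) =
      fun θ : Fin 3 → ℝ => (ContinuousMultilinearMap.compContinuousLinearMapL (fun _ : Fin 3 => (ContinuousLinearMap.id ℝ ℝ).smulRight u)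
        (iteratedFDeriv ℝ 3 H (((ContinuousLinearMap.id ℝ ℝ).smulRight u) 0 + θ))) (fun _ => (1 : ℝ)) := by
    funext θ
    rw [iteratedDeriv_eq_iteratedFDeriv]
    have h := iteratedFDeriv_comp_affine (n := 3) hH ((ContinuousLinearMap.id ℝ ℝ).smulRight u) θ hn
    have hfun : (fun s : ℝ => H (s • u + θ)) = fun p : ℝ => H (((ContinuousLinearMap.id ℝ ℝ).smulRight u) p + θ) := by
      funext s; simp only [ContinuousLinearMap.smulRight_apply, ContinuousLinearMap.id_apply]
    rw [hfun, h]
    rfl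
  rw [heq]
  have hc : Continuous fun θ : Fin 3 → ℝ => iteratedFDeriv ℝ 3 H (((ContinuousLinearMap.id ℝ ℝ).smulRight u) 0 + θ) :=
    (hH.continuous_iteratedFDeriv hn).comp (continuous_const.add continuous_id)
  exact (ContinuousMultilinearMap.apply ℝ (fun _ : Fin 3 => ℝ) ℂ (fun _ => (1 : ℝ))).continuous.comp
    ((ContinuousMultilinearMap.compContinuousLinearMapL fun _ : Fin 3 => (ContinuousLinearMap.id ℝ ℝ).smulRight u).continuous.comp hc)

end Line

section Chamber

/-- **ONE CONE: A `C³` CORNER EXTENSION GIVES THE LETTER'S LIMIT FROM THAT CONE.**  For ANY `Φ : (S¹)³ → ℂ`, a centre `ζ`, an OPEN set `C` of angles and a `C³` function `H` with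
`ρ′Δ(ζe^{iθ})·Φ(ζe^{iθ}) = H(θ)` for `θ ∈ C` near `0`: `Λ₈[ρ′Δ·Φ](ζe^{iθ}) → (1∕48)Σ_ε s₀s₁s₂·(d∕ds)³|₀ H(s·V_ε)` as `θ → 0` within `C` (the letter's tokens, ★ p842205, at the chart point).
[cite: Rogawski1990, §8.4 p. 126] [cite: HormanderALPDO1, Thm. 1.1.9] -/
theorem tendsto_lambda8_rhoWeylDelta_nhdsWithin_of_contDiff (Φ : (Fin 3 → Circle) → ℂ) (ζ : Circle) (C : Set (Fin 3 → ℝ)) (hC : IsOpen C)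
    (H : (Fin 3 → ℝ) → ℂ) (hH : ContDiff ℝ 3 H)
    (hagree : ∀ᶠ θ in 𝓝[C] (0 : Fin 3 → ℝ),
      (((((fun k : Fin 3 => ζ * Circle.exp (θ k)) 0 : Circle) : ℂ) * ((((fun k : Fin 3 => ζ * Circle.exp (θ k)) 2 : Circle) : ℂ))⁻¹) * ((1 - (((fun k : Fin 3 => ζ * Circle.exp (θ k)) 1 : Circle) : ℂ) * ((((fun k : Fin 3 => ζ * Circle.exp (θ k)) 0 : Circle) : ℂ))⁻¹) * (1 - (((fun k : Fin 3 => ζ * Circle.exp (θ k)) 2 : Circle) : ℂ) * ((((fun k : Fin 3 => ζ * Circle.exp (θ k)) 1 : Circle) : ℂ))⁻¹) * (1 - (((fun k : Fin 3 => ζ * Circle.exp (θ k)) 2 : Circle) : ℂ) * ((((fun k : Fin 3 => ζ * Circle.exp (θ k)) 0 : Circle) : ℂ))⁻¹))) * Φ (fun k : Fin 3 => ζ * Circle.exp (θ k)) = H θ) :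
    Tendsto (fun θ : Fin 3 → ℝ =>
        (1 / 48 : ℂ) * ∑ ε : Fin 3 → Bool, ((((if ε 0 then (1 : ℝ) else -1) * (if ε 1 then (1 : ℝ) else -1) * (if ε 2 then (1 : ℝ) else -1) : ℝ)) : ℂ) *
          iteratedDeriv 3 (fun s : ℝ => ((((((ζ * Circle.exp (θ 0) * Circle.exp (s * (![(if ε 0 then (1 : ℝ) else -1) + (if ε 1 then (1 : ℝ) else -1), -(if ε 0 then (1 : ℝ) else -1) + (if ε 2 then (1 : ℝ) else -1), -(if ε 1 then (1 : ℝ) else -1) - (if ε 2 then (1 : ℝ) else -1)] 0))) : Circle) : ℂ)) * ((((ζ * Circle.exp (θ 2) * Circle.exp (s * (![(if ε 0 then (1 : ℝ) else -1) + (if ε 1 then (1 : ℝ) else -1), -(if ε 0 then (1 : ℝ) else -1) + (if ε 2 then (1 : ℝ) else -1), -(if ε 1 then (1 : ℝ) else -1) - (if ε 2 then (1 : ℝ) else -1)] 2))) : Circle) : ℂ))⁻¹) * ((1 - ((((ζ * Circle.exp (θ 1) * Circle.exp (s * (![(if ε 0 then (1 : ℝ) else -1) + (if ε 1 then (1 :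 ℝ) else -1), -(if ε 0 then (1 : ℝ) else -1) + (if ε 2 then (1 : ℝ) else -1), -(if ε 1 then (1 : ℝ) else -1) - (if ε 2 then (1 : ℝ) else -1)] 1))) : Circle) : ℂ)) * ((((ζ * Circle.exp (θ 0) * Circle.exp (s * (![(if ε 0 then (1 : ℝ) else -1) + (if ε 1 then (1 : ℝ) else -1), -(if ε 0 then (1 : ℝ) else -1) + (if ε 2 then (1 : ℝ) else -1), -(if ε 1 then (1 : ℝ) else -1) - (if ε 2 then (1 : ℝ) else -1)] 0))) : Circle) : ℂ))⁻¹) * (1 - ((((ζ * Circle.exp (θ 2) * Circle.exp (s * (![(if ε 0 then (1 : ℝ) else -1) + (if ε 1 then (1 : ℝ) else -1), -(if ε 0 then (1 : ℝ) else -1) + (if ε 2 then (1 : ℝ) else -1), -(if ε 1 then (1 : ℝ) else -1) - (if ε 2 then (1 : ℝ) else -1)] 2))) : Circle) : ℂ)) * ((((ζ * Circle.exp (θ 1) * Circle.exp (s * (![(if ε 0 then (1 : ℝ) else -1) + (if ε 1 then (1 : ℝ) else -1), -(if ε 0 then (1 : ℝ) else -1) + (if ε 2 then (1 : ℝ) else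 -1), -(if ε 1 then (1 : ℝ) else -1) - (if ε 2 then (1 : ℝ) else -1)] 1))) : Circle) : ℂ))⁻¹) * (1 - ((((ζ * Circle.exp (θ 2) * Circle.exp (s * (![(if ε 0 then (1 : ℝ) else -1) + (if ε 1 then (1 : ℝ) else -1), -(if ε 0 then (1 : ℝ) else -1) + (if ε 2 then (1 : ℝ) else -1), -(if ε 1 then (1 : ℝ) else -1) - (if ε 2 then (1 : ℝ) else -1)] 2))) : Circle) : ℂ)) * ((((ζ * Circle.exp (θ 0) * Circle.exp (s * (![(if ε 0 then (1 : ℝ) else -1) + (if ε 1 then (1 : ℝ) else -1), -(if ε 0 then (1 : ℝ) else -1) + (if ε 2 then (1 : ℝ) else -1), -(if ε 1 then (1 : ℝ) else -1) - (if ε 2 then (1 : ℝ) else -1)] 0))) : Circle) : ℂ))⁻¹))) * (Φ (fun k => ζ * Circle.exp (θ k) * Circle.exp (s * (![(if ε 0 then (1 : ℝ) else -1) + (if ε 1 then (1 : ℝ) else -1), -(if ε 0 then (1 : ℝ) else -1) + (if ε 2 then (1 : ℝ) else -1), -(if ε 1 then (1 : ℝ) else -1) - (if ε 2 then (1 : ℝ)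 else -1)] k))))) 0)
      (𝓝[C] (0 : Fin 3 → ℝ))
      (𝓝 ((1 / 48 : ℂ) * ∑ ε : Fin 3 → Bool, ((((if ε 0 then (1 : ℝ) else -1) * (if ε 1 then (1 : ℝ) else -1) * (if ε 2 then (1 : ℝ) else -1) : ℝ)) : ℂ) * iteratedDeriv 3 (fun s : ℝ => H (s • (![(if ε 0 then (1 : ℝ) else -1) + (if ε 1 then (1 : ℝ) else -1), -(if ε 0 then (1 : ℝ) else -1) + (if ε 2 then (1 : ℝ) else -1), -(if ε 1 then (1 : ℝ) else -1) - (if ε 2 then (1 : ℝ) else -1)]))) 0)) := by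
  -- an open set `W ∋ 0` on which the agreement holds inside `C`
  obtain ⟨W, ⟨hW0, hWo⟩, hW⟩ := (nhdsWithin_basis_open (0 : Fin 3 → ℝ) C).eventually_iff.1 hagree
  -- the points of the rays: `ζ e^{iθ_k} e^{isu_k} = ζ e^{i(s·u + θ)_k}`
  have hpt : ∀ (u θ : Fin 3 → ℝ) (s : ℝ) (k : Fin 3), ζ * Circle.exp (θ k) * Circle.exp (s * u k) = ζ * Circle.exp ((s • u + θ) k) := by
    intro u θ s k
    rw [mul_assoc, ← Circle.exp_add]
    congr 2
    simp only [Pi.add_apply, Pi.smul_apply, smul_eq_mul]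
    ring
  -- on `W ∩ C` every ray third derivative is that of `s ↦ H(s·u + θ)`
  have hray : ∀ θ ∈ W ∩ C, ∀ u : Fin 3 → ℝ,
      iteratedDeriv 3 (fun s : ℝ => ((((((ζ * Circle.exp (θ 0) * Circle.exp (s * (u 0))) : Circle) : ℂ)) * ((((ζ * Circle.exp (θ 2) * Circle.exp (s * (u 2))) : Circle) : ℂ))⁻¹) * ((1 - ((((ζ * Circle.exp (θ 1) * Circle.exp (s * (u 1))) : Circle) : ℂ)) * ((((ζ * Circle.exp (θ 0) * Circle.exp (s * (u 0))) : Circle) : ℂ))⁻¹) * (1 - ((((ζ * Circle.exp (θ 2) * Circle.exp (s * (u 2))) : Circle) : ℂ)) * ((((ζ * Circle.exp (θ 1) * Circle.exp (s * (u 1))) : Circle) : ℂ))⁻¹) * (1 - ((((ζ * Circle.exp (θ 2) * Circle.exp (s * (u 2))) : Circle) : ℂ)) * ((((ζ * Circle.exp (θ 0) * Circle.exp (s * (u 0))) : Circle) : ℂ))⁻¹))) * (Φ (fun k => ζ * Circle.exp (θ k) * Circle.exp (s * (u k))))) 0 =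
        iteratedDeriv 3 (fun s : ℝ => H (s • u + θ)) 0 := by
    intro θ hθ u
    refine Filter.EventuallyEq.iteratedDeriv_eq 3 ?_
    have hcont : Continuous fun s : ℝ => s • u + θ := (continuous_id.smul continuous_const).add continuous_const
    have hmem : ∀ᶠ s : ℝ in 𝓝 0, s • u + θ ∈ W ∩ C := by
      refine hcont.continuousAt.eventually_mem ((hWo.inter hC).mem_nhds ?_)
      simpa only [zero_smul, zero_add] using hθ
    filter_upwards [hmem] with s hs
    have h := hW hs
    simp only [hpt u θ s] at h ⊢
    exact h
  -- the continuous model functional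
  have hcont : Continuous fun θ : Fin 3 → ℝ => (1 / 48 : ℂ) * ∑ ε : Fin 3 → Bool, ((((if ε 0 then (1 : ℝ) else -1) * (if ε 1 then (1 : ℝ) else -1) * (if ε 2 then (1 : ℝ) else -1) : ℝ)) : ℂ) *
      iteratedDeriv 3 (fun s : ℝ => H (s • (![(if ε 0 then (1 : ℝ) else -1) + (if ε 1 then (1 : ℝ) else -1), -(if ε 0 then (1 : ℝ) else -1) + (if ε 2 then (1 : ℝ) else -1), -(if ε 1 then (1 : ℝ) else -1) - (if ε 2 then (1 : ℝ) else -1)]) + θ)) 0 :=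
    continuous_const.mul (continuous_finsetSum _ fun ε _ => continuous_const.mul (continuous_iteratedDeriv_three_line_of_contDiff hH _))
  have hlim := (hcont.tendsto 0).mono_left (nhdsWithin_le_nhds (s := C))
  simp only [add_zero] at hlim
  refine hlim.congr' ?_
  have hWC : W ∩ C ∈ 𝓝[C] (0 : Fin 3 → ℝ) := Filter.inter_mem (mem_nhdsWithin_of_mem_nhds (hWo.mem_nhds hW0)) self_mem_nhdsWithin
  filter_upwards [hWC] with θ hθ
  simp only [hray θ hθ]

end Chamber

end Literature.NumberTheory.Rogawski1990

end
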